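/-
Copyright: lit-balaban Phase-2 proof seat p31 (gen 4).  Statement-level skeleton of a published paper; no proof claims beyond what the
kernel checks below.
-/
import Literature.MathematicalPhysics.QuantumFieldTheory.BalabanImbrieJaffe1984to88.BIJ88Eq552CutoffWitness

/-!
# `BalabanImbrieJaffe1984to88.BIJ88Eq552CutoffLocus` — T. Bałaban, J. Imbrie, A. Jaffe, *Effective action and cluster properties of the
abelian Higgs model*, Commun. Math. Phys. **114** (1988) 257–315 [BalabanImbrieJaffe1988], (5.5.2) p. 283 / p. 284 l.1–2: the EXACT LOCUS
of the cut-off defect of `BIJ88Eq552CutoffWitness` (GAPS.md G-C2-08) — `QΛ*C^{(k)}_{loc}` VANISHES at every L-bond that does not straddle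
`∂Λ` (both blocks inside `Λ`: by (2.10); both outside: nothing is kept), for EVERY `C̃`; and (2.11) for the witness `C̃ = E_{b₀b₀}`

statement-level skeleton of published theorems with citation tags; proofs where landed; nothing here is a claim about the Yang–Mills mass gap

PDF held: `paper:balaban1988-cmp114-bij-abelian-higgs-effective-action` (journal page = PDF page + 256); pp. 261, 280, 283–284 read from the
materialised text layer this session; [BalabanImbrieJaffe1985] p. 304 (2.13)/(2.15) for the contour geometry (`BIJ85Eq219Proof`,
`BIJ85Eq213AdjointExplicit`).

CITATION HEADER (lean-in-tree rule).  Part of the lit-balaban TYPED SKELETON (HOME `run/shared/lean/pub/lit-balaban/`), Phase-2 seat p31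
(gen 4, own lane = the torus block geometry); row **C2.Eq5.5.1-5.5.12**, member (5.5.2) (§5 fold owner r16, referee ref-5); successor of
`BIJ88Eq552CutoffWitness` (p250740), making the «locus» sentence of GAPS.md G-C2-08 kernel-checked.

THE PRINTED TEXT (verbatim).  p. 283: *"The translation we actually use is localized, and is given by A′ = A^{(k)} −
Λ₄^{(k)*}L^{−2}C^{(k)}_{loc}H*_{k,loc}∂*Q^{e*}_{k+1}f. (5.5.2)"*; p. 284 l.1–2: *"Our construction of a C^{(k)}_{loc} satisfying (2.10), (2.11)
ensures that δ_Ax(A′) = δ_Ax(A^{(k)}), δ(QA′) = δ(QA^{(k)})."*; [BalabanImbrieJaffe1985] p. 304: *"the bonds b which enter the sum (2.13) range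
over the interior of the two L-blocks B(b′₋) and B(b′₊), as well as the (surface) bonds"*.

WHAT IS SHOWN (kernel geometry + linear algebra, nothing asserted beyond it).  With the concrete (2.13) kernel `Q = BIJ85Eq213Adjoint.qKer` and
the cut-off `Λ* = BIJ88Eq552CutoffWitness.cutStar S` (`Λ = ⋃_{y∈S}B(y)`):
(1) `blocks_of_qKer_ne_zero`: `Q(c, b) ≠ 0` forces BOTH endpoints of `b` into `B(c₋) ∪ B(c₊)` (the p. 304 sentence, as a support statement);
(2) `qKer_mul_cutStar_apply_of_mem`: at an L-bond `c` with `B(c₋), B(c₊) ⊂ Λ` the cut-off is invisible, `(QΛ*M)(c, ·) = (QM)(c, ·)` for every `M`;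
    `qKer_mul_cutStar_apply_of_not_mem`: at an L-bond with both blocks outside `Λ`, `(QΛ*M)(c, ·) = 0`;
(3) `cutoff_locus`: hence `(QΛ*C^{(k)}_{loc})(c, ·) = 0` at every NON-straddling `c`, for every `C̃` — together with
    `BIJ88Eq552CutoffWitness.cutoff_witness` (`≠ 0` at the straddling bonds for a specific admissible `C̃`): the defect of G-C2-08 lives exactly
    on the `∂Λ`-straddling L-bonds;
(4) `eq211_single_witness`: the witness `C̃ = E_{b₀b₀}` does satisfy (2.11) on every family of axial contours made of bonds of the axial tree
    of record (`BIJ88RenormTransf311.IsAxialBond`), by p02's `BIJ88Eq211Proof.eq211_of_tree` — so it is admissible for the sentence p. 284 l.1–2.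
Unit `lit-balaban-p31` (literature-prover-lit-balaban-p31-g4-0), 2026-08-21.
-/

open scoped BigOperators

namespace Literature.MathematicalPhysics.QuantumFieldTheory.BalabanImbrieJaffe1984to88.BIJ88Eq552CutoffLocus

open Literature.MathematicalPhysics.QuantumFieldTheory.Balaban1983to89
open BIJ85Sect2SurfaceAverages LatticeFieldCalculus BIJ85Eq219Proof BIJ85Eq213Adjoint BIJ85Eq213AdjointExplicit BIJ88Eq211Proof
  BIJ88Eq210Torus BIJ88RenormTransf311 BIJ88Eq552CutoffWitness

variable {P : Params} {j : ℕ}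

/-! ## 1. Which unit bonds the contours of an L-bond see -/

/-- Every fine site is a `blockSite` of its block (standing range; `Site.blockEquiv`). [folklore] -/
private theorem exists_eq_blockSite (hj : j + 1 ≤ P.m + P.K) (x : Balaban1983to89.Site P j) :
    ∃ r : Fin P.d → Fin P.L, x = Site.blockSite (blockOf x) r := by
  refine ⟨Site.blockEquiv hj (blockOf x) ⟨x, rfl⟩, ?_⟩
  have h := (Site.blockEquiv hj (blockOf x)).symm_apply_apply ⟨x, rfl⟩
  exact (congrArg Subtype.val h).symm

/-- `(y − e_μ) + e_μ = y`. [folklore] -/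
private theorem shift_unshift {k : ℕ} (y : Balaban1983to89.Site P k) (μ : Fin P.d) : (y.unshift μ).shift μ = y := by
  funext κ
  by_cases hκ : κ = μ
  · subst hκ
    simp [Balaban1983to89.Site.shift, Balaban1983to89.Site.unshift]
  · simp [Balaban1983to89.Site.shift, Balaban1983to89.Site.unshift, Function.update_of_ne hκ]

open Classical in
/-- kernel geometry of (2.13): the kernel `Q(c, b)` of `c = ⟨y, y + e_μ⟩` vanishes unless BOTH endpoints of the unit bond `b` lie in
`B(y) ∪ B(y + e_μ)` — *"the bonds b which enter the sum (2.13) range over the interior of the two L-blocks B(b′₋) and B(b′₊), as well as the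
(surface) bonds"*. [cite: BalabanImbrieJaffe1985, (2.13) p.304] -/
theorem blocks_of_qKer_ne_zero (hj : j + 1 ≤ P.m + P.K) {c : PBond P (j + 1)} {b : PBond P j} (h : qKer P j c b ≠ 0) :
    (blockOf b.src = c.src ∨ blockOf b.src = c.src.shift c.dir) ∧ (blockOf b.tgt = c.src ∨ blockOf b.tgt = c.src.shift c.dir) := by
  obtain ⟨x, ν⟩ := b
  obtain ⟨s, hs⟩ := exists_eq_blockSite hj x
  generalize hy' : blockOf x = y' at hs
  subst hs
  have hsrc : blockOf (Site.blockSite y' s : Balaban1983to89.Site P j) = y' := Site.blockOf_blockSite hj y' s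
  have hc : runCount c ⟨Site.blockSite y' s, ν⟩ ≠ 0 := by
    intro h0
    apply h
    unfold qKer
    rw [h0, Nat.cast_zero, mul_zero]
  rw [runCount_blockSite hj y' s ν c] at hc
  have htgt := BIJ85Eq219Proof.blockOf_tgt hj (⟨Site.blockSite y' s, ν⟩ : PBond P j)
  simp only [hsrc] at htgt ⊢
  by_cases h1 : c = ⟨y', ν⟩
  · subst h1
    exact ⟨Or.inl rfl, htgt⟩
  · rw [if_neg h1] at hc
    by_cases h2 : c = ⟨y'.unshift ν, ν⟩
    · subst h2
      have hy : (y'.unshift ν).shift ν = y' := shift_unshift y' ν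
      refine ⟨Or.inr hy.symm, Or.inr ?_⟩
      rw [if_pos rfl] at hc
      have hlt : (s ν : ℕ) + 1 < P.L := by
        have := (s ν).isLt
        omega
      have ht : PBond.tgt (⟨Site.blockSite y' s, ν⟩ : PBond P j) = runSite (Site.blockSite y' s) ν 1 := by
        rw [runSite_succ, runSite_zero]
        rfl
      rw [hy, ht]
      exact blockOf_runSite_blockSite_of_lt hj y' s ν hlt
    · rw [if_neg h2] at hc
      exact absurd rfl hc

/-! ## 2. The cut-off is invisible at L-bonds inside `Λ`, and kills everything at L-bonds outside `Λ` -/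

open Classical in
/-- At an L-bond `c` with BOTH endpoint blocks in `Λ` the cut-off is invisible to (2.13): `(QΛ*M)(c, ·) = (QM)(c, ·)` for every `M`.
[cite: BalabanImbrieJaffe1988, (5.5.2) p.283] -/
theorem qKer_mul_cutStar_apply_of_mem (hj : j + 1 ≤ P.m + P.K) (S : Finset (Balaban1983to89.Site P (j + 1)))
    (M : Matrix (PBond P j) (PBond P j) ℝ) (c : PBond P (j + 1)) (h1 : c.src ∈ S) (h2 : c.src.shift c.dir ∈ S) (b₀ : PBond P j) :
    (qKer P j * (cutStar S * M)) c b₀ = (qKer P j * M) c b₀ := by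
  rw [Matrix.mul_apply, Matrix.mul_apply]
  refine Finset.sum_congr rfl fun b _ => ?_
  rw [cutStar_mul_apply]
  by_cases hq : qKer P j c b = 0
  · rw [hq, zero_mul, zero_mul]
  · obtain ⟨hs, ht⟩ := blocks_of_qKer_ne_zero hj hq
    have hin : blockOf b.src ∈ S ∧ blockOf b.tgt ∈ S := by
      constructor
      · rcases hs with h | h <;> rw [h] <;> assumption
      · rcases ht with h | h <;> rw [h] <;> assumption
    rw [if_pos hin, one_mul]

open Classical in
/-- At an L-bond `c` with BOTH endpoint blocks outside `Λ` the cut-off deletes every bond the contours of `c` see: `(QΛ*M)(c, ·) = 0`.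
[cite: BalabanImbrieJaffe1988, (5.5.2) p.283] -/
theorem qKer_mul_cutStar_apply_of_not_mem (hj : j + 1 ≤ P.m + P.K) (S : Finset (Balaban1983to89.Site P (j + 1)))
    (M : Matrix (PBond P j) (PBond P j) ℝ) (c : PBond P (j + 1)) (h1 : c.src ∉ S) (h2 : c.src.shift c.dir ∉ S) (b₀ : PBond P j) :
    (qKer P j * (cutStar S * M)) c b₀ = 0 := by
  rw [Matrix.mul_apply]
  refine Finset.sum_eq_zero fun b _ => ?_
  rw [cutStar_mul_apply]
  by_cases hq : qKer P j c b = 0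
  · rw [hq, zero_mul]
  · obtain ⟨hs, -⟩ := blocks_of_qKer_ne_zero hj hq
    have hout : ¬ (blockOf b.src ∈ S ∧ blockOf b.tgt ∈ S) := by
      intro hin
      rcases hs with h | h
      · exact h1 (h ▸ hin.1)
      · exact h2 (h ▸ hin.1)
    rw [if_neg hout, zero_mul, mul_zero]

/-! ## 3. The locus of the defect -/

open Classical in
/-- **LOCUS of the G-C2-08 defect.**  `(QΛ*C^{(k)}_{loc})(c, ·) = 0` at every L-bond `c` that does NOT straddle `∂Λ` — both blocks inside
(the cut-off is invisible there and (2.10) `QC_loc = 0` applies) or both outside — for EVERY `C̃`; whereas at the straddling bonds it is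
`≠ 0` for the admissible witness `C̃ = E_{b₀b₀}` (`BIJ88Eq552CutoffWitness.cutoff_witness`). [cite: BalabanImbrieJaffe1988, (5.5.2) p.283] -/
theorem cutoff_locus (hj : j + 1 ≤ P.m + P.K) (S : Finset (Balaban1983to89.Site P (j + 1))) (Ct : Matrix (PBond P j) (PBond P j) ℝ)
    (c : PBond P (j + 1)) (hc : (c.src ∈ S ↔ c.src.shift c.dir ∈ S)) (b₀ : PBond P j) :
    (qKer P j * (cutStar S * clocKer (qKer P j) (qstKer P j) (qsKer (torusBlockBonds P j)) (qsstKer (torusBlockBonds P j)) Ct)) c b₀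
      = 0 := by
  by_cases h1 : c.src ∈ S
  · rw [qKer_mul_cutStar_apply_of_mem hj S _ c h1 (hc.1 h1) b₀]
    have h' : qKer P j * clocKer (qKer P j) (qstKer P j) (qsKer (torusBlockBonds P j)) (qsstKer (torusBlockBonds P j)) Ct = 0 := by
      have h'' := qKer_mul_clocKer_mul hj Ct 1
      rwa [Matrix.mul_one] at h''
    rw [h', Matrix.zero_apply]
  · exact qKer_mul_cutStar_apply_of_not_mem hj S _ c h1 (fun h => h1 (hc.2 h)) b₀

open Classical in
/-- The same in words of the translation (5.5.2): for every bond function `g` (= `H*_{k,loc}∂*Q^{e*}_{k+1}f`) the block averages of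
`A^{(k)}` and of `A′ = A^{(k)} − L^{−2}Λ*C_loc g` AGREE at every non-straddling L-bond. [cite: BalabanImbrieJaffe1988, (5.5.2) p.283] -/
theorem bondAvg_transl_eq_of_not_straddling (hj : j + 1 ≤ P.m + P.K) (S : Finset (Balaban1983to89.Site P (j + 1)))
    (Ct : Matrix (PBond P j) (PBond P j) ℝ) (Lsq : ℝ) (A g : PBond P j → ℝ) (c : PBond P (j + 1)) (hc : (c.src ∈ S ↔ c.src.shift c.dir ∈ S)) :
    (qKer P j).mulVec (A - Lsq • (cutStar S * clocKer (qKer P j) (qstKer P j) (qsKer (torusBlockBonds P j)) (qsstKer (torusBlockBonds P j)) Ct).mulVec g) c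
      = (qKer P j).mulVec A c := by
  rw [Matrix.mulVec_sub, Matrix.mulVec_smul, Matrix.mulVec_mulVec, Pi.sub_apply, Pi.smul_apply]
  have h0 : ((qKer P j * (cutStar S * clocKer (qKer P j) (qstKer P j) (qsKer (torusBlockBonds P j)) (qsstKer (torusBlockBonds P j)) Ct)).mulVec g) c = 0 := by
    rw [Matrix.mulVec, dotProduct]
    exact Finset.sum_eq_zero fun b _ => by rw [cutoff_locus hj S Ct c hc b, zero_mul]
  rw [h0, smul_zero, sub_zero]

/-! ## 4. (2.11) for the witness `C̃ = E_{b₀b₀}` -/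

open Classical in
/-- The witness `C̃ = E_{b₀b₀}` of `BIJ88Eq552CutoffWitness` satisfies **(2.11)** on every family `Γ` of axial contours made of bonds of the
axial tree of record (`BIJ88RenormTransf311.IsAxialBond`; tree bonds are interior, `BIJ88RenormTransf311.blockOf_tgt`), by p02's
`BIJ88Eq211Proof.eq211_of_tree` fed with `single_witness_rows_cols`. [cite: BalabanImbrieJaffe1988, (2.11) p.261] -/
theorem eq211_single_witness (hj : j + 1 ≤ P.m + P.K) (hd : 2 ≤ P.d) (y : Balaban1983to89.Site P (j + 1)) {ι : Type*}
    (Γ : ι → Finset (PBond P j)) (hΓ : ∀ i, ∀ b ∈ Γ i, IsAxialBond b) :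
    BIJ88Sect2Statements.Eq211 Γ (fun b b' => clocKer (qKer P j) (qstKer P j) (qsKer (torusBlockBonds P j)) (qsstKer (torusBlockBonds P j))
      (Matrix.single (witnessBond hd y) (witnessBond hd y) (1 : ℝ)) b b') :=
  eq211_of_tree Γ {b : PBond P j | IsAxialBond b} hΓ (qKer P j) (qstKer P j) (qsKer (torusBlockBonds P j)) (qsstKer (torusBlockBonds P j))
    (Matrix.single (witnessBond hd y) (witnessBond hd y) (1 : ℝ))
    (fun b hb b' => (single_witness_rows_cols hj hd y b (mem_axialBonds.2 hb) b').1)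
    (fun b hb b' => (single_witness_rows_cols hj hd y b (mem_axialBonds.2 hb) b').2)
    (fun b hb c' => qsstKer_interior (torusBlockBonds P j)
      (show blockOf b.src = blockOf b.tgt from (BIJ88RenormTransf311.blockOf_tgt hj hb).symm) c')
    (fun b hb c' => qsKer_interior (torusBlockBonds P j)
      (show blockOf b.src = blockOf b.tgt from (BIJ88RenormTransf311.blockOf_tgt hj hb).symm) c')

end Literature.MathematicalPhysics.QuantumFieldTheory.BalabanImbrieJaffe1984to88.BIJ88Eq552CutoffLocus
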